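import Summits.QuantumFields.YangMills.Theorems.MirrorModularBoostsSoftKernelBoostCovarianceDiagCloudGrowthHelpers
import Summits.QuantumFields.YangMills.Theorems.CurvatureSandwichBound.Negative.Unbundled
import Summits.QuantumFields.YangMills.Theorems.IsotropyFromPowerCountingCurvatureSandwichBoundChainEngine
import HarnessLib

/-!
# `MirrorModularBoosts.SoftKernelBoostCovariance`, line `Sketch`: stub (D) `stub_diagCloudGrowth`
# — growth of the unordered norms of a chain in front of an UNORDERED off-diagonal cloud

Stub `stub_diagCloudGrowth` (D) of crux `stmt-QuantumFields-14999`
(`Summit.QuantumFields.YangMills.Theses.MirrorModularBoosts.SoftKernelBoostCovariance`), line `Sketch` (lead c13,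
skeleton v3.12), in the registered text.

Setting. A one-species Schwinger family `S₁` on `ℝ⁴` with an `e₀`-reconstruction `h` (E2 on time-ORDERED test
functions), E3 (`IsSymmetric` on `⁰𝒮`) and the function residual `NPointRegular S₁`; the chain step
`P ⟨m, G⟩ = ⟨2 + m, τ_a (J₁ ⊗ (J₂ ⊗ τ_a G))⟩` whose translated one-slot insertions `τ_a J₁`, `τ_a J₂` have times in
`[α₁, β₁]`, `(β₁, β₂]`, `β₂ < α₁ + 2a⁰`, `α₁ > 0`.  HYPOTHESIS: for every TIME-ORDERED cloud `Z` with all times `≥ α₁`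
the chain `Pᴺ Z` is time-ordered with `‖Ψ_{PᴺZ}‖ ≤ Lᴺ ‖Ψ_Z‖`.  CLAIM: for every off-diagonal cloud `G₀` with all times
`≥ α₁` (positive-time but UNORDERED, so that only the unordered pairing `⟪X, X⟫_S = 𝔖(ΘX* ⊗ X)` makes sense) there is
`K ≥ 0` (`K = Re ⟪G₀, G₀⟫`) with `Pᴺ G₀` positive-time, off-diagonal and `Re ⟪PᴺG₀, PᴺG₀⟫ ≤ K · L^{2N}`.

Proof. Only the ONE-STEP bound `‖Ψ_{PZ}‖ ≤ L ‖Ψ_Z‖` (`N = 1`) is used; the claim follows by induction on `N`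
(`Pᴺ⁺¹ G₀ = Pᴺ (P G₀)`, and `P` preserves "off-diagonal with all times `≥ α₁`") from the one-step unordered bound
`Re ⟪PG, PG⟫ ≤ L² Re ⟪G, G⟫`, `0 ≤ Re ⟪G, G⟫` for such clouds `G`, which is proved by sector regularisation:
`c_k G = ∑_π (T_{k,π})^π` with `T_{k,π}` time-ordered (`UnorderedRP.exists_orderedPieces`; the pieces live in the
sectors, which are disjoint, so they inherit the support bound "times `≥ α₁`"), `0 ≤ c_k ≤ m!`, `c_k → 1` off the
equal-time walls.  The step `G ↦ τ_a (J₁ ⊗ (J₂ ⊗ τ_a G))` is linear, commutes with permutations of the cloud slots and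
is local (`P(c G) = (c ∘ cloud slots) · P G`), so by E3 (`UnorderedRP.osPairing_permTest`)
`⟪P(c_k G), P(c_k G)⟫ = ∑_{π,π'} ⟪P T_{k,π}, P T_{k,π'}⟫ = ⟪P Z_k, P Z_k⟫ = ‖Ψ_{P Z_k}‖²` with the time-ordered
`Z_k = ∑_π T_{k,π}`, `≤ L² ‖Ψ_{Z_k}‖² = L² Re ⟪c_k G, c_k G⟫`; `k → ∞` on both sides by dominated convergence under
`NPointRegular` (`UnorderedRP.tendsto_osPairing`).  Positivity / off-diagonality of `P G`: the three blocks
`τ_a J₁`, `τ_a J₂`, `τ_{2a} G` have time-separated supports (one-slot functions are trivially off-diagonal).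

References: K. Osterwalder, R. Schrader, Comm. Math. Phys. 31 (1973) §2–4, 42 (1975) §4; J. Glimm, A. Jaffe,
*Quantum Physics* (1987) §10.5 (multiple reflections); folklore.  No `def`; the chain-step bookkeeping (linearity,
locality, permutations, supports, off-diagonality, sector-piece supports) is the companion helper file
`…SoftKernelBoostCovarianceDiagCloudGrowthHelpers.lean` (registered sub-goal `stub_diagCloudGrowthHelpers`); the
one-step bound `DiagCloud.step_growth` is here.
-/

noncomputable section

namespace Summit.QuantumFields.YangMills.Theorems.SoftKernelBoostCovariance.Sketch

open scoped BigOperators SchwartzMap ComplexConjugate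
open MeasureTheory Filter Topology
open Literature.MathematicalPhysics.QuantumLattice Literature.MathematicalPhysics.AQFT
  Literature.MathematicalPhysics.QuantumFieldTheory
open Summit.QuantumFields.YangMills.Theorems.NPointIsotropy.Negative (E4 NPointRegular)
open Summit.QuantumFields.YangMills.Theorems.NPointIsotropy.QuarterTurnCornerOperator
open Summit.QuantumFields.YangMills.Theorems.CurvatureSandwichBound.Sketch (re_pairing_self_eq_norm_sq)

namespace DiagCloud

/-! ## The one-step unordered bound -/

/-- **One chain step in front of an unordered off-diagonal cloud.** For a family with `e₀`-reconstruction `h`, E3 and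
`NPointRegular`, insertions as in the stub, and the one-step time-ordered bound `‖Ψ_{PZ}‖ ≤ L ‖Ψ_Z‖` for time-ordered
clouds `Z` with all times `≥ α₁`: for every off-diagonal cloud `G` with all times `≥ α₁`,
`0 ≤ Re ⟪G, G⟫_S` and `Re ⟪PG, PG⟫_S ≤ L² · Re ⟪G, G⟫_S` (sector regularisation, E3 transport, the hypothesis on
`Z_k = ∑_π T_{k,π}`, and dominated convergence `k → ∞` on both sides). [folklore] -/
theorem step_growth (S : SchwingerFamily E4) (h : OSReconstructionNoE1 S.toLabelled) (hE3 : S.toLabelled.IsSymmetric)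
    (hreg : NPointRegular S) {a : E4} {J₁ J₂ : 𝓢((Fin 1 → E4), ℂ)} {α₁ β₁ β₂ L : ℝ}
    (hα₁ : 0 < α₁) (hαβ : α₁ ≤ β₁) (hβ : β₁ < β₂) (hβ₂ : β₂ < α₁ + 2 * a 0)
    (hJ₁ : tsupport (translateMulti a J₁ : (Fin 1 → E4) → ℂ) ⊆ {x | α₁ ≤ x 0 0 ∧ x 0 0 ≤ β₁})
    (hJ₂ : tsupport (translateMulti a J₂ : (Fin 1 → E4) → ℂ) ⊆ {x | β₁ < x 0 0 ∧ x 0 0 ≤ β₂})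
    (hgrow : ∀ (n : ℕ) (Z : 𝓢((Fin n → E4), ℂ)) (hZ : IsTimeOrdered Z),
      tsupport (Z : (Fin n → E4) → ℂ) ⊆ {x | ∀ i, α₁ ≤ x i 0} →
      ∃ hN : IsTimeOrdered (translateMulti a (J₁.appendTensor (J₂.appendTensor (translateMulti a Z)))),
        ‖h.fieldVec (1 + (1 + n)) (fun _ => ())
            (translateMulti a (J₁.appendTensor (J₂.appendTensor (translateMulti a Z)))) hN‖ ≤
          L * ‖h.fieldVec n (fun _ => ()) Z hZ‖)
    {m : ℕ} (G : 𝓢((Fin m → E4), ℂ)) (hGo : IsOffDiagonal G)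
    (hGs : tsupport (G : (Fin m → E4) → ℂ) ⊆ {x | ∀ i, α₁ ≤ x i 0}) :
    0 ≤ (S.osPairing G G).re ∧
      (S.osPairing (translateMulti a (J₁.appendTensor (J₂.appendTensor (translateMulti a G))))
        (translateMulti a (J₁.appendTensor (J₂.appendTensor (translateMulti a G))))).re ≤
        L ^ 2 * (S.osPairing G G).re := by
  -- positivity from the support bound, and the sector decomposition of the cloud
  have hpos_of : ∀ {k : ℕ} {X : 𝓢((Fin k → E4), ℂ)},
      tsupport (X : (Fin k → E4) → ℂ) ⊆ {x | ∀ i, α₁ ≤ x i 0} → IsPositiveTimeMulti X :=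
    fun hX x hx i => hα₁.trans_le (hX hx i)
  have hGp : IsPositiveTimeMulti G := hpos_of hGs
  obtain ⟨T, c, hT, hsum, hc, hc1⟩ := UnorderedRP.exists_orderedPieces G hGp
  have hTs : ∀ k π, tsupport (T k π : (Fin m → E4) → ℂ) ⊆ {x | ∀ i, α₁ ≤ x i 0} := fun k π =>
    tsupport_piece_subset (hT k) (hsum k) (isClosed_setOf_forall_le α₁) (fun x σ hx i => hx (σ i)) hGs π
  -- the regularised clouds `Gk = ∑_π (T k π)^π = c_k • G` and the time-ordered clouds `Zk = ∑_π T k π`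
  set Gk : ℕ → 𝓢((Fin m → E4), ℂ) := fun k => ∑ π, permTest π (T k π) with hGkdef
  set Zk : ℕ → 𝓢((Fin m → E4), ℂ) := fun k => ∑ π, T k π with hZkdef
  have hGk_apply : ∀ k x, Gk k x = (c k x : ℂ) * G x := fun k x => hsum k x
  have hGks : ∀ k, tsupport (Gk k : (Fin m → E4) → ℂ) ⊆ {x | ∀ i, α₁ ≤ x i 0} :=
    fun k => (closure_mono fun x hx => by
      rw [Function.mem_support] at hx ⊢
      intro h0
      exact hx (by rw [hGk_apply k x, h0, mul_zero])).trans hGs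
  have hGko : ∀ k, IsOffDiagonal (Gk k) := fun k =>
    UnorderedRP.isOffDiagonal_sum _ _ fun π _ => UnorderedRP.isOffDiagonal_permTest (hT k π).isOffDiagonal π
  have hZk : ∀ k, IsTimeOrdered (Zk k) := fun k => tsupport_sum_subset _ _ fun π _ => hT k π
  have hZks : ∀ k, tsupport (Zk k : (Fin m → E4) → ℂ) ⊆ {x | ∀ i, α₁ ≤ x i 0} :=
    fun k => tsupport_sum_subset _ _ fun π _ => hTs k π
  -- positivity / off-diagonality after the chain step
  have hPTp : ∀ k π,
      IsPositiveTimeMulti (translateMulti a (J₁.appendTensor (J₂.appendTensor (translateMulti a (T k π))))) :=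
    fun k π => hpos_of (tsupport_step_subset hαβ hβ hβ₂ hJ₁ hJ₂ (hTs k π))
  have hPTo : ∀ k π,
      IsOffDiagonal (translateMulti a (J₁.appendTensor (J₂.appendTensor (translateMulti a (T k π))))) :=
    fun k π => isOffDiagonal_step hβ hβ₂ hJ₁ hJ₂ (hT k π).isOffDiagonal (hTs k π)
  have hPGkp : ∀ k,
      IsPositiveTimeMulti (translateMulti a (J₁.appendTensor (J₂.appendTensor (translateMulti a (Gk k))))) :=
    fun k => hpos_of (tsupport_step_subset hαβ hβ hβ₂ hJ₁ hJ₂ (hGks k))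
  have hPGko : ∀ k, IsOffDiagonal (translateMulti a (J₁.appendTensor (J₂.appendTensor (translateMulti a (Gk k))))) :=
    fun k => isOffDiagonal_step hβ hβ₂ hJ₁ hJ₂ (hGko k) (hGks k)
  have hPGp : IsPositiveTimeMulti (translateMulti a (J₁.appendTensor (J₂.appendTensor (translateMulti a G)))) :=
    hpos_of (tsupport_step_subset hαβ hβ hβ₂ hJ₁ hJ₂ hGs)
  have hPGo : IsOffDiagonal (translateMulti a (J₁.appendTensor (J₂.appendTensor (translateMulti a G)))) :=
    isOffDiagonal_step hβ hβ₂ hJ₁ hJ₂ hGo hGs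
  -- (E3) the regularised pairings are pairings of the time-ordered `Zk`, before and after the chain step
  have hpairG : ∀ k, S.osPairing (Gk k) (Gk k) = S.osPairing (Zk k) (Zk k) := by
    intro k
    rw [hGkdef, hZkdef]
    dsimp only
    rw [UnorderedRP.osPairing_sum_sum, UnorderedRP.osPairing_sum_sum]
    refine Finset.sum_congr rfl fun π _ => Finset.sum_congr rfl fun π' _ => ?_
    exact UnorderedRP.osPairing_permTest S hE3 (UnorderedRP.isOffDiagonal_osAdjoint_appendTensor
      (hT k π).isPositiveTimeMulti (hT k π).isOffDiagonal (hT k π').isPositiveTimeMulti (hT k π').isOffDiagonal) π π'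
  have hpairPG : ∀ k,
      S.osPairing (translateMulti a (J₁.appendTensor (J₂.appendTensor (translateMulti a (Gk k)))))
          (translateMulti a (J₁.appendTensor (J₂.appendTensor (translateMulti a (Gk k))))) =
        S.osPairing (translateMulti a (J₁.appendTensor (J₂.appendTensor (translateMulti a (Zk k)))))
          (translateMulti a (J₁.appendTensor (J₂.appendTensor (translateMulti a (Zk k))))) := by
    intro k
    rw [hGkdef, hZkdef]
    dsimp only
    rw [step_sum, step_sum, UnorderedRP.osPairing_sum_sum, UnorderedRP.osPairing_sum_sum]
    refine Finset.sum_congr rfl fun π _ => Finset.sum_congr rfl fun π' _ => ?_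
    rw [step_permTest, step_permTest]
    exact UnorderedRP.osPairing_permTest S hE3
      (UnorderedRP.isOffDiagonal_osAdjoint_appendTensor (hPTp k π) (hPTo k π) (hPTp k π') (hPTo k π')) _ _
  -- the time-ordered bound for `Zk`, read through E3
  have hineq : ∀ k, 0 ≤ (S.osPairing (Gk k) (Gk k)).re ∧
      (S.osPairing (translateMulti a (J₁.appendTensor (J₂.appendTensor (translateMulti a (Gk k)))))
        (translateMulti a (J₁.appendTensor (J₂.appendTensor (translateMulti a (Gk k)))))).re ≤
        L ^ 2 * (S.osPairing (Gk k) (Gk k)).re := by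
    intro k
    obtain ⟨hN, hle⟩ := hgrow m (Zk k) (hZk k) (hZks k)
    have e0 : (S.osPairing (Zk k) (Zk k)).re = ‖h.fieldVec m (fun _ => ()) (Zk k) (hZk k)‖ ^ 2 :=
      re_pairing_self_eq_norm_sq S h (Zk k) (hZk k)
    have e1 : (S.osPairing (translateMulti a (J₁.appendTensor (J₂.appendTensor (translateMulti a (Zk k)))))
        (translateMulti a (J₁.appendTensor (J₂.appendTensor (translateMulti a (Zk k)))))).re =
        ‖h.fieldVec (1 + (1 + m)) (fun _ => ())
          (translateMulti a (J₁.appendTensor (J₂.appendTensor (translateMulti a (Zk k))))) hN‖ ^ 2 :=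
      re_pairing_self_eq_norm_sq S h _ hN
    rw [hpairG, hpairPG, e0, e1]
    refine ⟨sq_nonneg _, ?_⟩
    calc ‖h.fieldVec (1 + (1 + m)) (fun _ => ())
            (translateMulti a (J₁.appendTensor (J₂.appendTensor (translateMulti a (Zk k))))) hN‖ ^ 2
        ≤ (L * ‖h.fieldVec m (fun _ => ()) (Zk k) (hZk k)‖) ^ 2 := pow_le_pow_left₀ (norm_nonneg _) hle 2
      _ = L ^ 2 * ‖h.fieldVec m (fun _ => ()) (Zk k) (hZk k)‖ ^ 2 := by ring
  -- the limits `k → ∞` (dominated convergence under `NPointRegular`)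
  have hlimG : Tendsto (fun k => S.osPairing (Gk k) (Gk k)) atTop (𝓝 (S.osPairing G G)) :=
    UnorderedRP.tendsto_osPairing S hreg hGp hGo hGp hGo Gk Gk (fun k => hpos_of (hGks k)) hGko
      (fun k => hpos_of (hGks k)) hGko c c hGk_apply hGk_apply _ _ hc hc hc1 hc1
  have hlimPG : Tendsto (fun k =>
      S.osPairing (translateMulti a (J₁.appendTensor (J₂.appendTensor (translateMulti a (Gk k)))))
        (translateMulti a (J₁.appendTensor (J₂.appendTensor (translateMulti a (Gk k)))))) atTop
      (𝓝 (S.osPairing (translateMulti a (J₁.appendTensor (J₂.appendTensor (translateMulti a G))))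
        (translateMulti a (J₁.appendTensor (J₂.appendTensor (translateMulti a G)))))) :=
    UnorderedRP.tendsto_osPairing S hreg hPGp hPGo hPGp hPGo
      (fun k => translateMulti a (J₁.appendTensor (J₂.appendTensor (translateMulti a (Gk k)))))
      (fun k => translateMulti a (J₁.appendTensor (J₂.appendTensor (translateMulti a (Gk k)))))
      hPGkp hPGko hPGkp hPGko
      (fun k y => c k (fun j => y (Fin.natAdd 1 (Fin.natAdd 1 j)) - a - a))
      (fun k y => c k (fun j => y (Fin.natAdd 1 (Fin.natAdd 1 j)) - a - a))
      (fun k y => step_apply_of_apply_eq_mul a J₁ J₂ (hGk_apply k) y)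
      (fun k y => step_apply_of_apply_eq_mul a J₁ J₂ (hGk_apply k) y) _ _
      (fun k _ => hc k _) (fun k _ => hc k _)
      (fun y hy => hc1 _ (injective_cloud a hy)) (fun y hy => hc1 _ (injective_cloud a hy))
  have hreG := (Complex.continuous_re.tendsto _).comp hlimG
  have hrePG := (Complex.continuous_re.tendsto _).comp hlimPG
  exact ⟨ge_of_tendsto' hreG fun k => (hineq k).1,
    le_of_tendsto_of_tendsto' hrePG (hreG.const_mul (L ^ 2)) fun k => (hineq k).2⟩

end DiagCloud

/-- **Stub (D) `stub_diagCloudGrowth` — UNORDERED CLOUDS** (crux `MirrorModularBoosts.SoftKernelBoostCovariance`,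
stmt-QuantumFields-14999, line `Sketch`, registered text).  For a one-species family `S₁` on `ℝ⁴` with an
`e₀`-reconstruction `h`, E3 and the function residual `NPointRegular S₁`, the chain step
`P ⟨m, G⟩ = ⟨2 + m, τ_a (J₁ ⊗ (J₂ ⊗ τ_a G))⟩` with translated insertions in the time windows `[α₁, β₁]`, `(β₁, β₂]`,
`β₂ < α₁ + 2a⁰`, `α₁ > 0`, and the hypothesis that the chain in front of every TIME-ORDERED cloud with all times `≥ α₁`
is time-ordered and grows at most like `Lᴺ` in `h`-norm: for every off-diagonal (possibly UNORDERED) cloud `G₀` with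
all times `≥ α₁` there is `K ≥ 0` (`K = Re ⟪G₀, G₀⟫_{S₁}`) such that every `Pᴺ G₀` is positive-time and off-diagonal
with `Re ⟪Pᴺ G₀, Pᴺ G₀⟫_{S₁} ≤ K · L^{2N}`.  Induction on `N` from the one-step bound `DiagCloud.step_growth`.
[folklore] -/
theorem stub_diagCloudGrowth :
    open Literature.MathematicalPhysics.QuantumLattice Literature.MathematicalPhysics.AQFT
      Literature.MathematicalPhysics.QuantumFieldTheory
      Summit.QuantumFields.YangMills.Theorems.CurvatureSandwichBound.Negative
      Summit.QuantumFields.YangMills.Theorems.NPointIsotropy.Negative in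
    ∀ (S₁ : SchwingerFamily E4) (h : OSReconstructionNoE1 S₁.toLabelled),
      S₁.toLabelled.IsSymmetric → NPointRegular S₁ →
    ∀ (a : E4) (J₁ J₂ : SchwartzMap (Fin 1 → E4) ℂ) (α₁ β₁ β₂ L : ℝ),
      0 < α₁ → α₁ ≤ β₁ → β₁ < β₂ → β₂ < α₁ + 2 * a 0 → 0 ≤ L →
      tsupport (translateMulti a J₁ : (Fin 1 → E4) → ℂ) ⊆ {x | α₁ ≤ x 0 0 ∧ x 0 0 ≤ β₁} →
      tsupport (translateMulti a J₂ : (Fin 1 → E4) → ℂ) ⊆ {x | β₁ < x 0 0 ∧ x 0 0 ≤ β₂} →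
    ∀ (P : (Σ m : ℕ, SchwartzMap (Fin m → E4) ℂ) → (Σ m : ℕ, SchwartzMap (Fin m → E4) ℂ)),
      (P = fun Gσ => ⟨1 + (1 + Gσ.1),
        translateMulti a (J₁.appendTensor (J₂.appendTensor (translateMulti a Gσ.2)))⟩) →
      (∀ (n : ℕ) (Z : SchwartzMap (Fin n → E4) ℂ) (hZ : IsTimeOrdered Z),
          tsupport (Z : (Fin n → E4) → ℂ) ⊆ {x | ∀ i, α₁ ≤ x i 0} →
          ∀ N : ℕ, ∃ hN : IsTimeOrdered (P^[N] ⟨n, Z⟩).2,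
            ‖h.fieldVec (P^[N] ⟨n, Z⟩).1 (fun _ => ()) (P^[N] ⟨n, Z⟩).2 hN‖ ≤
              L ^ N * ‖h.fieldVec n (fun _ => ()) Z hZ‖) →
    ∀ (n₀ : ℕ) (G₀ : SchwartzMap (Fin n₀ → E4) ℂ), IsOffDiagonal G₀ →
      tsupport (G₀ : (Fin n₀ → E4) → ℂ) ⊆ {x | ∀ i, α₁ ≤ x i 0} →
    ∃ K : ℝ, 0 ≤ K ∧ ∀ N : ℕ,
      IsPositiveTimeMulti (P^[N] ⟨n₀, G₀⟩).2 ∧ IsOffDiagonal (P^[N] ⟨n₀, G₀⟩).2 ∧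
      (S₁.osPairing (P^[N] ⟨n₀, G₀⟩).2 (P^[N] ⟨n₀, G₀⟩).2).re ≤ K * L ^ (2 * N) := by
  intro S₁ h hE3 hreg a J₁ J₂ α₁ β₁ β₂ L hα₁ hαβ hβ hβ₂ hL hJ₁ hJ₂ P hP hgrow n₀ G₀ hG₀o hG₀s
  have hPA : ∀ A : Σ m : ℕ, 𝓢((Fin m → E4), ℂ),
      P A = ⟨1 + (1 + A.1), translateMulti a (J₁.appendTensor (J₂.appendTensor (translateMulti a A.2)))⟩ :=
    fun A => by rw [hP]
  -- the one-step time-ordered bound (`N = 1` of the hypothesis)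
  have hgrow1 : ∀ (n : ℕ) (Z : 𝓢((Fin n → E4), ℂ)) (hZ : IsTimeOrdered Z),
      tsupport (Z : (Fin n → E4) → ℂ) ⊆ {x | ∀ i, α₁ ≤ x i 0} →
      ∃ hN : IsTimeOrdered (translateMulti a (J₁.appendTensor (J₂.appendTensor (translateMulti a Z)))),
        ‖h.fieldVec (1 + (1 + n)) (fun _ => ())
            (translateMulti a (J₁.appendTensor (J₂.appendTensor (translateMulti a Z)))) hN‖ ≤
          L * ‖h.fieldVec n (fun _ => ()) Z hZ‖ := by
    intro n Z hZ hZs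
    have h1 := hgrow n Z hZ hZs 1
    rw [pow_one, Function.iterate_one, hPA] at h1
    exact h1
  -- induction on `N`, for every admissible starting cloud
  have key : ∀ (N : ℕ) (A : Σ m : ℕ, 𝓢((Fin m → E4), ℂ)), IsOffDiagonal A.2 →
      tsupport (A.2 : (Fin A.1 → E4) → ℂ) ⊆ {x | ∀ i, α₁ ≤ x i 0} →
      tsupport ((P^[N] A).2 : (Fin (P^[N] A).1 → E4) → ℂ) ⊆ {x | ∀ i, α₁ ≤ x i 0} ∧
        IsOffDiagonal (P^[N] A).2 ∧
        (S₁.osPairing (P^[N] A).2 (P^[N] A).2).re ≤ (S₁.osPairing A.2 A.2).re * L ^ (2 * N) := by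
    intro N
    induction N with
    | zero =>
      intro A hAo hAs
      refine ⟨hAs, hAo, ?_⟩
      simp
    | succ N ih =>
      intro A hAo hAs
      rw [Function.iterate_succ_apply]
      have hstep := DiagCloud.step_growth S₁ h hE3 hreg hα₁ hαβ hβ hβ₂ hJ₁ hJ₂ hgrow1 A.2 hAo hAs
      have hPAs : tsupport ((P A).2 : (Fin (P A).1 → E4) → ℂ) ⊆ {x | ∀ i, α₁ ≤ x i 0} := by
        rw [hPA]
        exact DiagCloud.tsupport_step_subset hαβ hβ hβ₂ hJ₁ hJ₂ hAs
      have hPAo : IsOffDiagonal (P A).2 := by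
        rw [hPA]
        exact DiagCloud.isOffDiagonal_step hβ hβ₂ hJ₁ hJ₂ hAo hAs
      have hPA2 : (S₁.osPairing (P A).2 (P A).2).re ≤ L ^ 2 * (S₁.osPairing A.2 A.2).re := by
        rw [hPA]
        exact hstep.2
      obtain ⟨h1, h2, h3⟩ := ih (P A) hPAo hPAs
      refine ⟨h1, h2, h3.trans ?_⟩
      calc (S₁.osPairing (P A).2 (P A).2).re * L ^ (2 * N)
          ≤ L ^ 2 * (S₁.osPairing A.2 A.2).re * L ^ (2 * N) := mul_le_mul_of_nonneg_right hPA2 (pow_nonneg hL _)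
        _ = (S₁.osPairing A.2 A.2).re * L ^ (2 * (N + 1)) := by ring
  refine ⟨(S₁.osPairing G₀ G₀).re,
    (DiagCloud.step_growth S₁ h hE3 hreg hα₁ hαβ hβ hβ₂ hJ₁ hJ₂ hgrow1 G₀ hG₀o hG₀s).1, fun N => ?_⟩
  obtain ⟨h1, h2, h3⟩ := key N ⟨n₀, G₀⟩ hG₀o hG₀s
  exact ⟨fun x hx i => hα₁.trans_le (h1 hx i), h2, h3⟩

end Summit.QuantumFields.YangMills.Theorems.SoftKernelBoostCovariance.Sketch

end
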